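import Literature.IUT.HodgeTheaters.InitialThetaDataLocalGroupsOpenProofs
import HarnessLib

/-!
# [IUTchI] Definition 3.1 (e)/(f): `Π_v̲ := Π_{X̲→_v̲}` is well defined up to INNER automorphism — the choice of the
# embedding `F̄ ↪ K̄_v̲` ("`G_v̲` … determined, up to `G_K`-conjugacy, by `v̲`") changes the base change by conjugation

S. Mochizuki, *Inter-universal Teichmüller theory I*, §3, Def. 3.1 (e) (kurims manuscript, May 2020, pp. 62–63)
[claim: Mochizuki2012, status: disputed]: "the various profinite groups `Π_(−)` admit natural outer surjections onto
the decomposition group `G_v̲ ⊆ G_K := Gal(F̄/K)` determined, up to `G_K`-conjugacy, by `v̲`"; (f) "If `v ∈ V̲^good`,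
then we shall write `Π_v := Π_{X̲→_v}`"; Ex. 3.3 (i) p. 77 "`D_v := 𝓑(X̲→_v̲)⁰`" (a category, defined up to equivalence).

PROOF-ONLY companion (theorems only; no definitions, no instances) of `InitialThetaDataLocalGalois` /
`InitialThetaDataLocalGroups` (abc-iut-L5-t2). The base change `D.PiLoc H (localToGF F k ι)` of a subgroup
`H ⊆ Π_{C_F}` (`= Π_{X̲→_K}, Π_{X_K}, Π_{C_K}, …`) along `Gal(Ω/k) → G_F` depends on the chosen `K`-embedding
`ι : F̄ → Ω` (`Ω = K̄_v̲`; `InitialThetaDataLocalGalois.localToGlobal_conj`: two embeddings give `G_K`-conjugate maps).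
Here: the dependence is an INNER automorphism of `Π_{C_F} × Gal(Ω/k)` by an element of `H × 1` —
* `PiLoc_eq_smul_of_conj` — if `ρ' = (augGF t)⁻¹ · ρ · (augGF t)` with `t ∈ H`, then
  `Π_{H,ρ'} = (t⁻¹, 1) · Π_{H,ρ} · (t⁻¹, 1)⁻¹`;
* `exists_localToGF_eq_conj` — `localToGF F k ι' = τ⁻¹ · localToGF F k ι · τ` for some `τ ∈ G_K`;
* **`exists_PiLoc_eq_conj_of_embeddings`** — for every `H ⊆ Π_{C_F}` with `H ↠ G_K` (`G_K ⊆ augGF(H)`) and any two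
  `K`-embeddings `ι, ι'`: `D.PiLoc H (localToGF F k ι') = (t⁻¹,1) · D.PiLoc H (localToGF F k ι) · (t⁻¹,1)⁻¹` for some
  `t ∈ H`; in particular for **`Π_v̲ := Π_{X̲→_v̲}`** (`PiLoc_PiXarrow_conj_of_embeddings`, via
  `galoisSubgroupOf_le_map_PiXarrow`) and for `Π_{X_v̲}, Π_{C_v̲}, Π_{X̲_v̲}, Π_{C̲_v̲}` (`…_of_PiXund_le`), whence
  `nonempty_mulEquiv_PiLoc_of_embeddings` — the groups for two choices are isomorphic by an inner automorphism, so
  `D_v̲ = 𝓑(Π_v̲)⁰` (Ex. 3.3 (i) at the datum, `goodLocalFrobenioidOfEmb D p k ι`) does not depend on `ι` up to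
  equivalence ("outer" in print).
Nothing of the series is asserted; no side is taken.
-/

noncomputable section

namespace Literature.IUT.HodgeTheaters

open scoped Pointwise

universe u v w w'

/-! ### Two `K`-embeddings `F̄ → Ω` give `G_K`-conjugate maps `Gal(Ω/k) → G_F` -/

section GK

variable (F : Type u) {K : Type v} {Fbar : Type w} [Field F] [Field K] [Algebra F K] [Field Fbar]
  [Algebra F Fbar] [Algebra K Fbar] [IsScalarTower F K Fbar] [Normal K Fbar]
  {Ω : Type w'} [Field Ω] [Algebra K Ω]
  (k : Type w') [Field k] [Algebra K k] [Algebra k Ω] [IsScalarTower K k Ω] (ι ι' : Fbar →ₐ[K] Ω)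

/-- **Def. 3.1 (e) "determined, up to `G_K`-conjugacy"**: for two `K`-embeddings `ι, ι' : F̄ → Ω` the maps
`Gal(Ω/k) → G_F` are conjugate by an element of `G_K`: `localToGF F k ι' σ = τ⁻¹ · localToGF F k ι σ · τ`.
[claim: Mochizuki2012, status: disputed] -/
theorem exists_localToGF_eq_conj : ∃ τ : Fbar ≃ₐ[F] Fbar, τ ∈ galoisSubgroupOf F K Fbar ∧
    ∀ σ : Ω ≃ₐ[k] Ω, localToGF F k ι' σ = τ⁻¹ * localToGF F k ι σ * τ := by
  obtain ⟨τ₀, -, hτ₀⟩ := localToGlobal_conj k ι ι'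
  refine ⟨AlgEquiv.restrictScalarsHom F τ₀, restrictScalars_mem_galoisSubgroupOf F τ₀, fun σ => ?_⟩
  change AlgEquiv.restrictScalarsHom F (localToGlobal k ι' σ) = _ * AlgEquiv.restrictScalarsHom F (localToGlobal k ι σ) * _
  rw [hτ₀, map_mul, map_mul, map_inv]

end GK

namespace InitialThetaData

/-! ### Conjugating `ρ` by `augGF t`, `t ∈ H`, conjugates the base change `Π_{H,ρ}` by `(t⁻¹, 1)` -/

section General

variable {F : Type u} {K : Type v} {Fbar : Type w} [Field F] [NumberField F] [Field K] [NumberField K]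
  [Algebra F K] [Field Fbar] [Algebra F Fbar] [Algebra K Fbar]
  {E : WeierstrassCurve F} [E.IsElliptic] {l : ℕ} {Pb : BadPlacePredicates K}
  (D : InitialThetaData F K Fbar E l Pb) {Γ : Type w'} [Group Γ] (ρ : Γ →* (Fbar ≃ₐ[F] Fbar))

/-- **Inner dependence of the base change on the augmentation datum**: if `ρ' σ = (augGF t)⁻¹ · ρ σ · augGF t` for
some `t ∈ H`, then `Π_{H,ρ'} = (t⁻¹,1) · Π_{H,ρ} · (t⁻¹,1)⁻¹` inside `Π_{C_F} × Γ` (`(x, σ) ∈ Π_{H,ρ'}` iff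
`(t x t⁻¹, σ) ∈ Π_{H,ρ}`). [claim: Mochizuki2012, status: disputed] -/
theorem PiLoc_eq_smul_of_conj {H : Subgroup D.PiC} {t : D.PiC} (ht : t ∈ H) (ρ' : Γ →* (Fbar ≃ₐ[F] Fbar))
    (hρ' : ∀ σ, ρ' σ = (D.augGF t)⁻¹ * ρ σ * D.augGF t) :
    D.PiLoc H ρ' = MulAut.conj ((t⁻¹, 1) : D.PiC × Γ) • D.PiLoc H ρ := by
  ext z
  rw [Subgroup.mem_pointwise_smul_iff_inv_smul_mem, MulAut.smul_def, MulAut.conj_inv_apply, mem_PiLoc, mem_PiLoc,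
    hρ']
  simp only [Prod.inv_mk, inv_inv, inv_one, Prod.fst_mul, Prod.snd_mul, one_mul, mul_one, map_mul, map_inv]
  constructor
  · rintro ⟨hzH, hz⟩
    refine ⟨H.mul_mem (H.mul_mem ht hzH) (H.inv_mem ht), ?_⟩
    rw [hz]
    group
  · rintro ⟨hzH, hz⟩
    refine ⟨?_, ?_⟩
    · have hmem := H.mul_mem (H.mul_mem (H.inv_mem ht) hzH) ht
      have heq : t⁻¹ * (t * z.1 * t⁻¹) * t = z.1 := by group
      rwa [heq] at hmem
    · rw [← hz]
      group

/-- The conjugate base changes are isomorphic (inner automorphism by `(t⁻¹, 1)`). [claim: Mochizuki2012, status: disputed] -/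
theorem nonempty_mulEquiv_PiLoc_of_conj {H : Subgroup D.PiC} {t : D.PiC} (ht : t ∈ H) (ρ' : Γ →* (Fbar ≃ₐ[F] Fbar))
    (hρ' : ∀ σ, ρ' σ = (D.augGF t)⁻¹ * ρ σ * D.augGF t) :
    Nonempty (D.PiLoc H ρ ≃* D.PiLoc H ρ') := by
  rw [D.PiLoc_eq_smul_of_conj ρ ht ρ' hρ']
  exact ⟨Subgroup.equivSMul _ _⟩

end General

/-! ### Two embeddings `F̄ ↪ K̄_v̲`: `Π_v̲` changes by an inner automorphism -/

section Embeddings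

variable {F : Type u} {K : Type v} {Fbar : Type w} [Field F] [NumberField F] [Field K] [NumberField K]
  [Algebra F K] [Field Fbar] [Algebra F Fbar] [Algebra K Fbar] [IsScalarTower F K Fbar] [Normal K Fbar]
  {E : WeierstrassCurve F} [E.IsElliptic] {l : ℕ} {Pb : BadPlacePredicates K}
  (D : InitialThetaData F K Fbar E l Pb)
  {Ω : Type w'} [Field Ω] [Algebra K Ω]
  (k : Type w') [Field k] [Algebra K k] [Algebra k Ω] [IsScalarTower K k Ω] (ι ι' : Fbar →ₐ[K] Ω)

/-- **For every `H ⊆ Π_{C_F}` surjecting onto `G_K`, the base changes along two `K`-embeddings `ι, ι' : F̄ → Ω` are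
conjugate by `(t⁻¹, 1)` for some `t ∈ H`** (`τ ∈ G_K` from `exists_localToGF_eq_conj` lifts to `t ∈ H`).
[claim: Mochizuki2012, status: disputed] -/
theorem exists_PiLoc_eq_conj_of_embeddings {H : Subgroup D.PiC} (hH : galoisSubgroupOf F K Fbar ≤ H.map D.augGF) :
    ∃ t ∈ H, D.PiLoc H (localToGF F k ι') =
      MulAut.conj ((t⁻¹, 1) : D.PiC × (Ω ≃ₐ[k] Ω)) • D.PiLoc H (localToGF F k ι) := by
  obtain ⟨τ, hτK, hτ⟩ := exists_localToGF_eq_conj F k ι ι'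
  obtain ⟨t, ht, htτ⟩ := hH hτK
  exact ⟨t, ht, D.PiLoc_eq_smul_of_conj (localToGF F k ι) ht (localToGF F k ι') fun σ => by rw [hτ, htτ]⟩

/-- Hence the base changes of such an `H` along two embeddings are ISOMORPHIC groups (by an inner automorphism).
[claim: Mochizuki2012, status: disputed] -/
theorem nonempty_mulEquiv_PiLoc_of_embeddings {H : Subgroup D.PiC}
    (hH : galoisSubgroupOf F K Fbar ≤ H.map D.augGF) :
    Nonempty (D.PiLoc H (localToGF F k ι) ≃* D.PiLoc H (localToGF F k ι')) := by
  obtain ⟨t, ht, h⟩ := D.exists_PiLoc_eq_conj_of_embeddings k ι ι' hH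
  rw [h]
  exact ⟨Subgroup.equivSMul _ _⟩

/-- **`Π_v̲ := Π_{X̲→_v̲}` is well defined up to inner automorphism**: for two `K`-embeddings `F̄ ↪ Ω = K̄_v̲`,
`Π_{X̲→_K} ×_{G_F,ι'} Gal(Ω/k) = (t⁻¹,1) · (Π_{X̲→_K} ×_{G_F,ι} Gal(Ω/k)) · (t⁻¹,1)⁻¹` with `t ∈ Π_{X̲→_K}`
(`Π_{X̲→_K} ↠ G_K`, `galoisSubgroupOf_le_map_PiXarrow`) — so `D_v̲ = 𝓑(Π_v̲)⁰` of Ex. 3.3 (i) at the datum is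
independent of the embedding up to equivalence. [claim: Mochizuki2012, status: disputed] -/
theorem PiLoc_PiXarrow_conj_of_embeddings :
    ∃ t ∈ D.PiXarrow, D.PiLoc D.PiXarrow (localToGF F k ι') =
      MulAut.conj ((t⁻¹, 1) : D.PiC × (Ω ≃ₐ[k] Ω)) • D.PiLoc D.PiXarrow (localToGF F k ι) :=
  D.exists_PiLoc_eq_conj_of_embeddings k ι ι' D.galoisSubgroupOf_le_map_PiXarrow

/-- `Π_v̲` for two embeddings: isomorphic groups. [claim: Mochizuki2012, status: disputed] -/
theorem nonempty_mulEquiv_PiLoc_PiXarrow_of_embeddings :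
    Nonempty (D.PiLoc D.PiXarrow (localToGF F k ι) ≃* D.PiLoc D.PiXarrow (localToGF F k ι')) :=
  D.nonempty_mulEquiv_PiLoc_of_embeddings k ι ι' D.galoisSubgroupOf_le_map_PiXarrow

/-- The same for every `Π_{(−)} ⊇ Π_{X̲_K}` (`Π_{X_K}, Π_{C_K}, Π_{X̲_K}, Π_{C̲_K}, Π_{C̲→_K}`: the groups
`Π_{X_v̲}, Π_{C_v̲}, Π_{X̲_v̲}, Π_{C̲_v̲}, Π_{C̲→_v̲}` of Def. 3.1 (e)/(f) are well defined up to inner automorphism).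
[claim: Mochizuki2012, status: disputed] -/
theorem PiLoc_conj_of_embeddings_of_PiXund_le {H : Subgroup D.PiC} (hH : D.PiXund ≤ H) :
    ∃ t ∈ H, D.PiLoc H (localToGF F k ι') =
      MulAut.conj ((t⁻¹, 1) : D.PiC × (Ω ≃ₐ[k] Ω)) • D.PiLoc H (localToGF F k ι) :=
  D.exists_PiLoc_eq_conj_of_embeddings k ι ι' (D.galoisSubgroupOf_le_map_of_PiXund_le hH)

/-- `Π_{C_v̲} := Π_{C_K} ×_{G_F} Gal(Ω/k)` for two embeddings: conjugate by `(t⁻¹,1)`, `t ∈ Π_{C_K}` — so the local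
§1 datum `D.peLoc k ι` (ambient `Π_{C_v̲}`) is well defined up to an inner automorphism of `Π_{C_F} × Gal(Ω/k)`
preserving `Π_{C_K} × Gal(Ω/k)`. [claim: Mochizuki2012, status: disputed] -/
theorem PiLoc_PiCK_conj_of_embeddings :
    ∃ t ∈ D.PiCK, D.PiLoc D.PiCK (localToGF F k ι') =
      MulAut.conj ((t⁻¹, 1) : D.PiC × (Ω ≃ₐ[k] Ω)) • D.PiLoc D.PiCK (localToGF F k ι) :=
  D.PiLoc_conj_of_embeddings_of_PiXund_le k ι ι' D.PiXund_le_PiCK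

end Embeddings

end InitialThetaData

end Literature.IUT.HodgeTheaters

end
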